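import Mathlib
import HarnessLib
import Summits.NavierStokesRegularity.NavierStokesRegularity.Theorems.SqueezeCycleExtremalBiaxialitySubcriticalPayerTomographyHessian
import Literature.Analysis.FluidPDE.PressureRepresentation
import Literature.Analysis.FluidPDE.TaoEnergyLocalisationPressure
import Literature.Analysis.FluidPDE.NewtonPotentialHolder
import Literature.Analysis.FluidPDE.LerayProfileCalculus

/-!
# Route `IsobarTomography`, crux `BlobRiccatiClosure` — line `type-i-apex-liouville`,
# stub `stub_hessianCentreLimit` (B2): convergence of the pressure Hessian at a point

Helper file for item `stmt-NavierStokesRegularity-11740`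
(`Summit.NavierStokesRegularity.NavierStokesRegularity.Theses.IsobarTomography.BlobRiccatiClosure`).

Main result `stub_hessianCentreLimit`: let `(v_j, q_j)` be `C⁴` divergence-free fields on `ℝ³`
with Poisson pressures `Δq_j = −div((v_j·∇)v_j)` obeying, eventually in `j`, the uniform bounds
`|v_j| ≤ M`, `‖∇v_j‖ ≤ M₁`, `‖∇q_j‖ ≤ B`, `|G_j| ≤ S`, `‖∇G_j‖ ≤ L` (`G_j = div((v_j·∇)v_j)`), and
let `(V, Q)` satisfy the same. If `∇v_j → ∇V` pointwise, then `D²q_j(x)(e,e) → D²Q(x)(e,e)` for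
every `x`, `e`.

Proof. For unit `e` and every `R > 0` the landed pointwise tomography
`exists_hessian_tomography_bound` (route `SqueezeCycle`, file `…PayerTomographyHessian`) gives
`|D²q(x)(e,e) + G(x)/3 + ∫_{|z|<R} D²Γ(z)(e,e)(G(x−z) − G(x)) dz| ≤ c₀ (M M₁/R + M²/R² + B/R)`
with the SAME right-hand side for every `j` and for the limit. `G_j(y) = tr(∇v_j(y) ∘ ∇v_j(y))`
(`divergence_convect_self_eq`) converges pointwise by continuity of `A ↦ tr A²`; the ball integral
converges by dominated convergence (`|D²Γ(z)(e,e)| ≤ 1/(2π|z|³)` via the pressure kernel,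
`|G_j(x−z) − G_j(x)| ≤ L|z|` by the mean value inequality, and `|z|⁻²` is integrable on balls of
`ℝ³`, `NewtonPotentialHolder.integrableOn_ball_norm_rpow_neg`); `R → ∞` kills the remainder
(an `ε/4`-argument). General `e` by homogeneity of `e ↦ D²q(x)(e,e)`.

Sources: D. Gilbarg, N. S. Trudinger, *Elliptic PDE of Second Order* (2001), Lemma 4.2 with
(4.9)–(4.10) [GilbargTrudinger2001] for the tomography identity; the rest is folklore
(dominated convergence). Not here: any statement about Navier–Stokes solutions (the lead's
assembly `stub_apexZoom` feeds zoomed velocity slices into this tool).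
-/

noncomputable section

open MeasureTheory Set Filter Metric Topology InnerProductSpace Function Real
open scoped RealInnerProductSpace Laplacian ContDiff ENNReal NNReal

namespace Summit.NavierStokesRegularity.NavierStokesRegularity.Theorems.BlobRiccatiClosure.TypeIApexLiouville

open Literature.Analysis Literature.Analysis.FluidPDE
open Summit.NavierStokesRegularity.NavierStokesRegularity.Theorems

-- summit and problem share the name `NavierStokesRegularity` (tree layout), as in every file here
set_option linter.dupNamespace false

-- nested operator types `ℝ³ →L[ℝ] ℝ³ →L[ℝ] ℝ³ →L[ℝ] ℝ`
set_option maxSynthPendingDepth 4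

/-- Euclidean `ℝ³` (the notation of the registered skeleton). -/
local notation "E³" => EuclideanSpace ℝ (Fin 3)

/-! ## Pointwise ingredients -/

/-- **Continuity of the source in the gradient.** `div((U·∇)U)(y) = tr(∇U(y) ∘ ∇U(y))` for a
divergence-free `C²` field (`divergence_convect_self_eq`), and `A ↦ tr(A ∘ A)` is continuous; so
if `∇v_j(y) → ∇V(y)` with `v_j` (eventually) and `V` divergence-free of class `C²`, then
`div((v_j·∇)v_j)(y) → div((V·∇)V)(y)`. [folklore] -/
theorem tendsto_divergence_convect_self {v : ℕ → E³ → E³} {V : E³ → E³} {y : E³}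
    (hv : ∀ᶠ j in atTop, ContDiff ℝ 2 (v j) ∧ VectorCalculus.IsDivFree (v j))
    (hV : ContDiff ℝ 2 V) (hVdiv : VectorCalculus.IsDivFree V)
    (hlim : Tendsto (fun j => fderiv ℝ (v j) y) atTop (𝓝 (fderiv ℝ V y))) :
    Tendsto (fun j => VectorCalculus.divergence (convect (v j) (v j)) y) atTop
      (𝓝 (VectorCalculus.divergence (convect V V) y)) := by
  have hφ : Continuous fun A : E³ →L[ℝ] E³ => (traceCLM : (E³ →L[ℝ] E³) →L[ℝ] ℝ) (A.comp A) :=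
    (traceCLM : (E³ →L[ℝ] E³) →L[ℝ] ℝ).continuous.comp
      ((continuous_id (X := E³ →L[ℝ] E³)).clm_comp continuous_id)
  have h1 : Tendsto (fun j => (traceCLM : (E³ →L[ℝ] E³) →L[ℝ] ℝ)
      ((fderiv ℝ (v j) y).comp (fderiv ℝ (v j) y))) atTop
      (𝓝 ((traceCLM : (E³ →L[ℝ] E³) →L[ℝ] ℝ) ((fderiv ℝ V y).comp (fderiv ℝ V y)))) :=
    (hφ.tendsto _).comp hlim
  rw [divergence_convect_self_eq hV hVdiv y]
  refine h1.congr' ?_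
  filter_upwards [hv] with j hj
  rw [divergence_convect_self_eq hj.1 hj.2 y]

/-- **Size of the quadrupole kernel**: `|D²Γ(z)(e,e)| ≤ |e|²/(2π|z|³)` for `z ≠ 0`
(`D²Γ(z)(e,e) = −K(z)(e)`, `K` the pressure kernel, `abs_pressureKernel_le`). [folklore] -/
theorem abs_fderiv2_newtonKernel_apply_self_le {z : E³} (hz : z ≠ 0) (e : E³) :
    |fderiv ℝ (fderiv ℝ newtonKernel) z e e| ≤ ‖e‖ ^ 2 / (2 * π * ‖z‖ ^ 3) := by
  have h' : fderiv ℝ (fderiv ℝ newtonKernel) z e e = -pressureKernel z e := by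
    rw [pressureKernel_eq_neg_fderiv2 hz e, neg_neg]
  rw [h', abs_neg]
  exact abs_pressureKernel_le z e

/-- **Mean value inequality**: `‖∇F‖ ≤ L` everywhere gives `|F(x − z) − F(x)| ≤ L|z|`. [folklore] -/
theorem abs_sub_le_mul_norm_of_norm_fderiv_le {F : E³ → ℝ} (hF : Differentiable ℝ F) {L : ℝ}
    (hL : ∀ y, ‖fderiv ℝ F y‖ ≤ L) (x z : E³) : |F (x - z) - F x| ≤ L * ‖z‖ := by
  have h := (convex_univ (𝕜 := ℝ) (E := E³)).norm_image_sub_le_of_norm_fderiv_le (𝕜 := ℝ)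
    (f := F) (fun y _ => hF y) (fun y _ => hL y) (mem_univ x) (mem_univ (x - z))
  rw [Real.norm_eq_abs, sub_sub_cancel_left, norm_neg] at h
  exact h

/-- **Domination of the tomography integrand**: for `z ≠ 0`, unit `e` and `‖∇F‖ ≤ L`,
`|D²Γ(z)(e,e) (F(x − z) − F(x))| ≤ (L/(2π)) |z|⁻²`. [folklore] -/
theorem norm_hess_mul_sub_le {F : E³ → ℝ} (hF : Differentiable ℝ F) {L : ℝ}
    (hL : ∀ y, ‖fderiv ℝ F y‖ ≤ L) (x : E³) {e : E³} (he : ‖e‖ = 1) {z : E³} (hz : z ≠ 0) :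
    ‖fderiv ℝ (fderiv ℝ newtonKernel) z e e * (F (x - z) - F x)‖ ≤
      L / (2 * π) * ‖z‖ ^ (-(2 : ℝ)) := by
  have hz' : 0 < ‖z‖ := norm_pos_iff.2 hz
  have hL0 : 0 ≤ L := (norm_nonneg _).trans (hL 0)
  rw [norm_mul, Real.norm_eq_abs, Real.norm_eq_abs]
  have h1 := abs_fderiv2_newtonKernel_apply_self_le hz e
  rw [he, one_pow] at h1
  have h2 := abs_sub_le_mul_norm_of_norm_fderiv_le hF hL x z
  have hrpow : ‖z‖ ^ (-(2 : ℝ)) = (‖z‖ ^ 2)⁻¹ := by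
    rw [Real.rpow_neg hz'.le, Real.rpow_two]
  calc |fderiv ℝ (fderiv ℝ newtonKernel) z e e| * |F (x - z) - F x|
      ≤ 1 / (2 * π * ‖z‖ ^ 3) * (L * ‖z‖) :=
        mul_le_mul h1 h2 (abs_nonneg _) (by positivity)
    _ = L / (2 * π) * ‖z‖ ^ (-(2 : ℝ)) := by
        rw [hrpow]
        field_simp

/-- **Measurability of the tomography integrand** `z ↦ D²Γ(z)(e,e) (F(x − z) − F(x))` for
continuous `F` (`D²Γ = fderiv (fderiv Γ)` is Borel measurable, `measurable_fderiv`). [folklore] -/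
theorem aestronglyMeasurable_hess_mul_sub {F : E³ → ℝ} (hF : Continuous F) (x e : E³)
    (μ : Measure E³) :
    AEStronglyMeasurable
      (fun z => fderiv ℝ (fderiv ℝ newtonKernel) z e e * (F (x - z) - F x)) μ := by
  have h1 : Measurable fun z : E³ => fderiv ℝ (fderiv ℝ newtonKernel) z e e :=
    (measurable_fderiv_apply_const ℝ (fderiv ℝ newtonKernel) e).apply_continuousLinearMap e
  have h2 : Continuous fun z : E³ => F (x - z) - F x :=
    (hF.comp (continuous_const.sub continuous_id)).sub continuous_const
  exact (h1.mul h2.measurable).aestronglyMeasurable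

/-! ## The two limits -/

/-- **Dominated convergence for the truncated quadrupole transform.** If `F_j → Φ` pointwise,
with `F_j` (eventually) of class `C¹` with `‖∇F_j‖ ≤ L`, then for unit `e` and every `R`,
`∫_{|z|<R} D²Γ(z)(e,e)(F_j(x−z) − F_j(x)) dz → ∫_{|z|<R} D²Γ(z)(e,e)(Φ(x−z) − Φ(x)) dz`
(domination by `(L/(2π))|z|⁻²`, integrable on balls of `ℝ³`). [folklore] -/
theorem tendsto_setIntegral_ball_hess_mul_sub {F : ℕ → E³ → ℝ} {Φ : E³ → ℝ} {L : ℝ} (R : ℝ)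
    (hF : ∀ᶠ j in atTop, ContDiff ℝ 1 (F j) ∧ ∀ y, ‖fderiv ℝ (F j) y‖ ≤ L)
    (hlim : ∀ y, Tendsto (fun j => F j y) atTop (𝓝 (Φ y))) (x : E³) {e : E³} (he : ‖e‖ = 1) :
    Tendsto (fun j => ∫ z in ball (0 : E³) R,
        fderiv ℝ (fderiv ℝ newtonKernel) z e e * (F j (x - z) - F j x)) atTop
      (𝓝 (∫ z in ball (0 : E³) R,
        fderiv ℝ (fderiv ℝ newtonKernel) z e e * (Φ (x - z) - Φ x))) := by
  refine tendsto_integral_filter_of_dominated_convergence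
    (fun z => L / (2 * π) * ‖z‖ ^ (-(2 : ℝ))) ?_ ?_ ?_ ?_
  · filter_upwards [hF] with j hj
    exact aestronglyMeasurable_hess_mul_sub hj.1.continuous x e _
  · have hae : ∀ᵐ z ∂(volume : Measure E³), z ≠ (0 : E³) := by
      rw [ae_iff]; simp
    filter_upwards [hF] with j hj
    filter_upwards [ae_restrict_of_ae (s := ball (0 : E³) R) hae] with z hz
    exact norm_hess_mul_sub_le (hj.1.differentiable one_ne_zero) hj.2 x he hz
  · exact (NewtonPotentialHolder.integrableOn_ball_norm_rpow_neg
      (by norm_num : (2 : ℝ) < 3) R).const_mul _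
  · exact Eventually.of_forall fun z => tendsto_const_nhds.mul ((hlim (x - z)).sub (hlim x))

/-- **The tomography remainder vanishes at infinity**: `c₀ (M M₁/R + M²/R² + B/R) → 0` as
`R → ∞`. [folklore] -/
theorem tendsto_tomography_remainder (c₀ M M₁ B : ℝ) :
    Tendsto (fun R : ℝ => c₀ * (M * M₁ / R + M ^ 2 / R ^ 2 + B / R)) atTop (𝓝 0) := by
  have h1 : Tendsto (fun R : ℝ => M * M₁ / R) atTop (𝓝 0) :=
    tendsto_const_nhds.div_atTop tendsto_id
  have h2 : Tendsto (fun R : ℝ => M ^ 2 / R ^ 2) atTop (𝓝 0) :=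
    tendsto_const_nhds.div_atTop (tendsto_pow_atTop two_ne_zero)
  have h3 : Tendsto (fun R : ℝ => B / R) atTop (𝓝 0) :=
    tendsto_const_nhds.div_atTop tendsto_id
  have h := ((h1.add h2).add h3).const_mul c₀
  rwa [add_zero, add_zero, mul_zero] at h

/-- **Bookkeeping for the `ε/4`-argument**: `|A_j + g_j/3 + I_j| ≤ δ`, `|A + g/3 + I| ≤ δ`,
`|(g_j/3 + I_j) − (g/3 + I)| < ε/2` and `δ < ε/4` give `|A_j − A| < ε`. [folklore] -/
theorem abs_sub_lt_of_tomography {Aj A gj g Ij I δ ε : ℝ} (h1 : |Aj + gj / 3 + Ij| ≤ δ)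
    (h2 : |A + g / 3 + I| ≤ δ) (h3 : |gj / 3 + Ij - (g / 3 + I)| < ε / 2) (h4 : δ < ε / 4) :
    |Aj - A| < ε := by
  obtain ⟨h1l, h1r⟩ := abs_le.1 h1
  obtain ⟨h2l, h2r⟩ := abs_le.1 h2
  obtain ⟨h3l, h3r⟩ := abs_lt.1 h3
  rw [abs_lt]
  constructor <;> linarith

/-! ## The stub -/

set_option maxHeartbeats 400000 in
/-- **Convergence of the pressure Hessian at a point, unit direction.** Under the hypotheses of
`stub_hessianCentreLimit` and `‖e‖ = 1`, `D²q_j(x)(e,e) → D²Q(x)(e,e)`: the tomography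
`exists_hessian_tomography_bound` at radius `R` for every `j` and for the limit, the two limits
`tendsto_divergence_convect_self` / `tendsto_setIntegral_ball_hess_mul_sub`, and `R → ∞`.
[cite: GilbargTrudinger2001, Lemma 4.2 (4.9)–(4.10)] -/
theorem tendsto_fderiv2_apply_self_of_norm_eq_one
    (v : ℕ → E³ → E³) (q : ℕ → E³ → ℝ) (V : E³ → E³) (Q : E³ → ℝ) (M M₁ B S L : ℝ) (x : E³)
    {e : E³}
    (hev : ∀ᶠ j in atTop, ContDiff ℝ 4 (v j) ∧ VectorCalculus.IsDivFree (v j) ∧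
        ContDiff ℝ 4 (q j) ∧
        (∀ y, ‖v j y‖ ≤ M) ∧ (∀ y, ‖fderiv ℝ (v j) y‖ ≤ M₁) ∧
        (∀ y, Laplacian.laplacian (q j) y = -VectorCalculus.divergence (convect (v j) (v j)) y) ∧
        (∀ y, ‖fderiv ℝ (q j) y‖ ≤ B) ∧
        (∀ y, ‖VectorCalculus.divergence (convect (v j) (v j)) y‖ ≤ S) ∧
        (∀ y, ‖fderiv ℝ (VectorCalculus.divergence (convect (v j) (v j))) y‖ ≤ L))
    (hV : ContDiff ℝ 4 V) (hVdiv : VectorCalculus.IsDivFree V) (hQ : ContDiff ℝ 4 Q)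
    (hMV : ∀ y, ‖V y‖ ≤ M) (hM₁V : ∀ y, ‖fderiv ℝ V y‖ ≤ M₁)
    (hΔQ : ∀ y, Laplacian.laplacian Q y = -VectorCalculus.divergence (convect V V) y)
    (hBQ : ∀ y, ‖fderiv ℝ Q y‖ ≤ B)
    (hSV : ∀ y, ‖VectorCalculus.divergence (convect V V) y‖ ≤ S)
    (hLV : ∀ y, ‖fderiv ℝ (VectorCalculus.divergence (convect V V)) y‖ ≤ L)
    (hlim : ∀ y, Tendsto (fun j => fderiv ℝ (v j) y) atTop (𝓝 (fderiv ℝ V y)))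
    (he : ‖e‖ = 1) :
    Tendsto (fun j => fderiv ℝ (fderiv ℝ (q j)) x e e) atTop
      (𝓝 (fderiv ℝ (fderiv ℝ Q) x e e)) := by
  obtain ⟨c₀, -, htool⟩ := exists_hessian_tomography_bound
  -- regularity of the sources `G_j = div((v_j·∇)v_j)`
  have hGreg : ∀ᶠ j in atTop, ContDiff ℝ 1 (VectorCalculus.divergence (convect (v j) (v j))) ∧
      ∀ y, ‖fderiv ℝ (VectorCalculus.divergence (convect (v j) (v j))) y‖ ≤ L := by
    filter_upwards [hev] with j hj
    obtain ⟨h4, -, -, -, -, -, -, -, hL⟩ := hj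
    have hu4 : ContDiff ℝ (3 + 1) (v j) := by exact_mod_cast h4
    have hW : ContDiff ℝ (1 + 1) (convect (v j) (v j)) :=
      (contDiff_convect_self hu4).of_le (by norm_num)
    exact ⟨contDiff_divergence hW, hL⟩
  -- pointwise convergence of the sources
  have hGlim : ∀ y, Tendsto (fun j => VectorCalculus.divergence (convect (v j) (v j)) y) atTop
      (𝓝 (VectorCalculus.divergence (convect V V) y)) := by
    intro y
    refine tendsto_divergence_convect_self ?_ (hV.of_le (by norm_num)) hVdiv (hlim y)
    filter_upwards [hev] with j hj
    exact ⟨hj.1.of_le (by norm_num), hj.2.1⟩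
  -- the `ε/4`-argument
  rw [Metric.tendsto_nhds]
  intro ε hε
  have hε4 : (0 : ℝ) < ε / 4 := by linarith
  have hε2 : (0 : ℝ) < ε / 2 := by linarith
  obtain ⟨R, hR, hRε⟩ : ∃ R : ℝ, 0 < R ∧ c₀ * (M * M₁ / R + M ^ 2 / R ^ 2 + B / R) < ε / 4 :=
    ((eventually_gt_atTop (0 : ℝ)).and
      ((tendsto_tomography_remainder c₀ M M₁ B).eventually (eventually_lt_nhds hε4))).exists
  -- convergence of the local part `G_j(x)/3 + I_R(G_j)`
  have hb : Tendsto (fun j => VectorCalculus.divergence (convect (v j) (v j)) x / 3 +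
      ∫ z in ball (0 : E³) R, fderiv ℝ (fderiv ℝ newtonKernel) z e e *
        (VectorCalculus.divergence (convect (v j) (v j)) (x - z) -
          VectorCalculus.divergence (convect (v j) (v j)) x)) atTop
      (𝓝 (VectorCalculus.divergence (convect V V) x / 3 +
        ∫ z in ball (0 : E³) R, fderiv ℝ (fderiv ℝ newtonKernel) z e e *
          (VectorCalculus.divergence (convect V V) (x - z) -
            VectorCalculus.divergence (convect V V) x))) :=
    ((hGlim x).div_const 3).add
      (tendsto_setIntegral_ball_hess_mul_sub
        (F := fun j => VectorCalculus.divergence (convect (v j) (v j))) R hGreg hGlim x he)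
  have hb' := Metric.tendsto_nhds.1 hb (ε / 2) hε2
  have hlimit := htool V Q M M₁ B S L R x e hV hVdiv hMV hM₁V hQ hΔQ hBQ hSV hLV hR he
  filter_upwards [hev, hb'] with j hj hbj
  obtain ⟨h4, hdiv, hq4, hM, hM₁, hΔ, hB, hS, hL⟩ := hj
  have hjtool := htool (v j) (q j) M M₁ B S L R x e h4 hdiv hM hM₁ hq4 hΔ hB hS hL hR he
  rw [Real.dist_eq] at hbj ⊢
  exact abs_sub_lt_of_tomography hjtool hlimit hbj hRε

set_option maxHeartbeats 400000 in
/-- **B2, CONVERGENCE OF THE PRESSURE HESSIAN AT A POINT (tomography).** Let `(v_j, q_j)` be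
`C⁴` divergence-free fields with Poisson pressures `Δq_j = −div((v_j·∇)v_j)` obeying, eventually
in `j`, the uniform bounds `|v_j| ≤ M`, `‖∇v_j‖ ≤ M₁`, `‖∇q_j‖ ≤ B`, `|G_j| ≤ S`, `‖∇G_j‖ ≤ L`
(`G_j = div((v_j·∇)v_j) = tr(∇v_j)²`), and let `(V, Q)` satisfy the same. If `∇v_j → ∇V`
pointwise, then `D²q_j(x)(e,e) → D²Q(x)(e,e)` for every `x`, `e`. Proof: the landed pointwise
tomography `exists_hessian_tomography_bound` (SqueezeCycle PayerTomographyHessian) gives, for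
unit `e` and every `R > 0`,
`D²q(x)(e,e) = −G(x)/3 − ∫_{|z|<R} D²Γ(z)(e,e)(G(x−z) − G(x))dz + O(1/R)` with the SAME `O(1/R)`
for all `j` and for the limit; `G_j → G` pointwise (continuity of
`A ↦ tr A²`), the ball integral converges by dominated convergence (integrand
`≤ ‖D²Γ(z)‖ L|z| ≲ L|z|⁻²`, integrable on a ball of `ℝ³`), and `R → ∞` kills the remainder;
general `e` by homogeneity. [cite: GilbargTrudinger2001, Lemma 4.2 (4.9)–(4.10)] -/
theorem stub_hessianCentreLimit :
    ∀ (v : ℕ → E³ → E³) (q : ℕ → E³ → ℝ) (V : E³ → E³) (Q : E³ → ℝ) (M M₁ B S L : ℝ)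
      (x e : E³),
      (∀ᶠ j in atTop, ContDiff ℝ 4 (v j) ∧ VectorCalculus.IsDivFree (v j) ∧ ContDiff ℝ 4 (q j) ∧
        (∀ y, ‖v j y‖ ≤ M) ∧ (∀ y, ‖fderiv ℝ (v j) y‖ ≤ M₁) ∧
        (∀ y, Laplacian.laplacian (q j) y = -VectorCalculus.divergence (convect (v j) (v j)) y) ∧
        (∀ y, ‖fderiv ℝ (q j) y‖ ≤ B) ∧
        (∀ y, ‖VectorCalculus.divergence (convect (v j) (v j)) y‖ ≤ S) ∧
        (∀ y, ‖fderiv ℝ (VectorCalculus.divergence (convect (v j) (v j))) y‖ ≤ L)) →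
      ContDiff ℝ 4 V → VectorCalculus.IsDivFree V → ContDiff ℝ 4 Q →
      (∀ y, ‖V y‖ ≤ M) → (∀ y, ‖fderiv ℝ V y‖ ≤ M₁) →
      (∀ y, Laplacian.laplacian Q y = -VectorCalculus.divergence (convect V V) y) →
      (∀ y, ‖fderiv ℝ Q y‖ ≤ B) →
      (∀ y, ‖VectorCalculus.divergence (convect V V) y‖ ≤ S) →
      (∀ y, ‖fderiv ℝ (VectorCalculus.divergence (convect V V)) y‖ ≤ L) →
      (∀ y, Tendsto (fun j => fderiv ℝ (v j) y) atTop (𝓝 (fderiv ℝ V y))) →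
      Tendsto (fun j => fderiv ℝ (fderiv ℝ (q j)) x e e) atTop
        (𝓝 (fderiv ℝ (fderiv ℝ Q) x e e)) := by
  intro v q V Q M M₁ B S L x e hev hV hVdiv hQ hMV hM₁V hΔQ hBQ hSV hLV hlim
  rcases eq_or_ne e 0 with rfl | hne
  · simp only [map_zero]
    exact tendsto_const_nhds
  -- homogeneity: `D²f(x)(e,e) = ‖e‖² D²f(x)(ê,ê)`, `ê = e/‖e‖`
  have hn : ‖e‖ ≠ 0 := norm_ne_zero_iff.2 hne
  have hê1 : ‖(‖e‖⁻¹ • e : E³)‖ = 1 := by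
    rw [norm_smul, norm_inv, norm_norm, inv_mul_cancel₀ hn]
  have key0 : ∀ (D : E³ →L[ℝ] E³ →L[ℝ] ℝ) (c : ℝ) (w : E³),
      D (c • w) (c • w) = c * (c * D w w) := by
    intro D c w
    simp only [map_smul, smul_apply, smul_eq_mul]
  have key : ∀ f : E³ → ℝ, fderiv ℝ (fderiv ℝ f) x e e =
      ‖e‖ * (‖e‖ * fderiv ℝ (fderiv ℝ f) x (‖e‖⁻¹ • e) (‖e‖⁻¹ • e)) := by
    intro f
    have h := key0 (fderiv ℝ (fderiv ℝ f) x) ‖e‖ (‖e‖⁻¹ • e)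
    rwa [smul_inv_smul₀ hn] at h
  have h := tendsto_fderiv2_apply_self_of_norm_eq_one v q V Q M M₁ B S L x hev hV hVdiv hQ hMV
    hM₁V hΔQ hBQ hSV hLV hlim hê1
  rw [key Q]
  refine ((h.const_mul ‖e‖).const_mul ‖e‖).congr fun j => ?_
  exact (key (q j)).symm

end Summit.NavierStokesRegularity.NavierStokesRegularity.Theorems.BlobRiccatiClosure.TypeIApexLiouville

end
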